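import Summits.BirchSwinnertonDyer.BirchSwinnertonDyer.Theorems.ByReductionTypeAtTwoKatoFreeSandwichAssembly
import Literature.NumberTheory.EllipticCurves.Rank1Residual.GVParityTwistTransportProofs
import HarnessLib

/-!
# Route `ByReductionTypeAtTwo` (K4), crux `OrdMissingLowerBoundAtTwo` (stmt-BirchSwinnertonDyer-19577) — line
# `kato-free-lower-sandwich-two` SPLIT BY THE IMAGE OF `ρ̄_{E,2}` (`--supports`, helper; conditional — closes nothing)

Cell `bsd-2adic`, lead `cruxlead-stmt-BirchSwinnertonDyer-19577` (g4).  THEOREMS ONLY — no definition, no named fact, no `sorry`;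
BSD is not proved by any of this.

The assembled line (p668589, `ordMissingLowerBoundAtTwo_of_published_of_lambdaHalf`) consumes the λ-half crux 19556
`OrdLambdaHalfAtTwo` WHOLESALE.  Crux 19556's registered skeleton (lead `cruxlead-19556`, 2026-08-28) proves it BY IMAGE:
`stub_irreducibleResidual : ∀ W, ¬CM → GoodOrd W 2 → E[2] irreducible → LambdaHalfAtTwo W` on one side, the Kato–Greenberg /
`W̄`-step / GL₁-print road on the `E[2]`-REDUCIBLE side.  This file records in the kernel that line kato-free-lower-sandwich-two is
IMAGE-LOCAL, so that either branch of 19556 closes the matching branch of 19577 modulo print, independently of the other: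

* §1 `missingLowerBoundAt_two_on_of_lambdaHalf_on` — for ANY isogeny-stable class `C` of curves: PUB ∧ Cassels ∧ Abbes–Ullmo ∧
  T2 ∧ (λ-half on the non-CM good-ordinary members of `C`) ⟹ item 19577 AT every non-CM rank-`0` good-ordinary `W ∈ C`.
  (The λ-half is used only at the `μ`-witness `W″ ∼ W`, which lies in `C`.)
* §2 irreducible branch, per curve and with NO isogeny input: `missingLowerBoundAt_two_of_irr_of_lambdaHalfAt` — at a non-CM
  rank-`0` good-ordinary `W` with `E[2]` irreducible, 19577 AT `W` ⟸ PUB ∧ Abbes–Ullmo ∧ `LambdaHalfAtTwo W` (the `μ`-witness is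
  `W` itself, `AnalyticMuTwo.analyticMuLE_two_zero_of_goodOrd_of_irr_of_abbesUllmo`); `∀`-form
  `missingLowerBoundAt_two_of_irr_of_lambdaHalfIrr`, whose λ-hypothesis is 19556's registered stub `stub_irreducibleResidual`
  VERBATIM.
* §3 reducible branch: `missingLowerBoundAt_two_of_red_of_lambdaHalfRed` — on the `E[2]`-reducible locus (a class property,
  `Rank1Residual.not_hasIrreducibleModPGaloisRep_of_isIsogenous`), 19577 ⟸ PUB ∧ Cassels ∧ Abbes–Ullmo ∧ T2 ∧ (λ-half on the
  non-CM good-ordinary `E[2]`-reducible curves).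
* §4 `ordMissingLowerBoundAtTwo_of_lambdaHalfIrr_of_lambdaHalfRed` — the LEAF from the two branch hypotheses (re-assembles
  p668589 with its λ-input split).
[cite: Kato2004Asterisque, Thm. 17.4] [cite: Stevens1989, §2] [cite: AbbesUllmo1996, Thm. A]
-/

set_option autoImplicit false
set_option linter.dupNamespace false

noncomputable section

open scoped Classical MatrixGroups ModularForm

open CongruenceSubgroup WeierstrassCurve Literature.NumberTheory.EllipticCurves
  Literature.NumberTheory.EllipticCurves.ModularForms Literature.NumberTheory.EllipticCurves.Rank1Residual
  Literature.NumberTheory.EllipticCurves.Rank1Residual.Typed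
  Literature.NumberTheory.EllipticCurves.Greenberg1999
  Summit.BirchSwinnertonDyer.Rank1Residual.X1.MuLambda
  Summit.BirchSwinnertonDyer.Rank1Residual.X1.MuPart
  Summit.BirchSwinnertonDyer.Rank1Residual.X5
  Summit.BirchSwinnertonDyer.Rank1Residual.X5.O1
  Summit.BirchSwinnertonDyer.Rank1Residual
  Summit.BirchSwinnertonDyer.BirchSwinnertonDyer.Theorems.TwoAdicTwistConverse
  Summit.BirchSwinnertonDyer.BirchSwinnertonDyer.Theorems.EisensteinLowerBounds
  Summit.BirchSwinnertonDyer.BirchSwinnertonDyer.Theorems.EisensteinShaCurrency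
  Summit.BirchSwinnertonDyer.BirchSwinnertonDyer.Theorems.IsogenyMuShift
  Summit.BirchSwinnertonDyer.BirchSwinnertonDyer.Theorems.KatoFreeSandwich

namespace Summit.BirchSwinnertonDyer.BirchSwinnertonDyer.Theorems.KatoFreeSandwich

/-! ## §1 The line is image-local: any isogeny-stable class -/

/-- **Item 19577 AT `W` for `W` in an isogeny-stable class `C`, from the λ-half ON `C` only** (plus PUB, Cassels,
Abbes–Ullmo and the `X₁(N)`-optimal datum T2).  The `μ_an ≤ 0` witness of the line — `W` itself when `W` has no rational
point of order `2` (§1b of the spine, mod Abbes–Ullmo), else the member `W″ ∼ W` of 2-adically maximal real period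
(`stub_maxPeriodWitness`, S2/S3/(W)/(β) through `stubAtMaxPeriod_of_periodDescentOfMeasureDepth`) — is isogenous to `W`, hence in
`C`, and the sandwich `missingLowerBoundAt_two_of_lambdaHalf_of_analyticMuLE` at `W″` needs the λ-half AT `W″` only; Cassels
(`missingLowerBoundAt_two_of_isIsogenous`) carries the inequality back to `W`.  Conditional; closes nothing.
[cite: Kato2004Asterisque, Thm. 17.4] [cite: Stevens1989, §2] [cite: AbbesUllmo1996, Thm. A] -/
theorem missingLowerBoundAt_two_on_of_lambdaHalf_on (C : WeierstrassCurve ℚ → Prop)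
    (hC : ∀ (W W'' : WeierstrassCurve ℚ) [W.IsElliptic] [W''.IsElliptic], IsIsogenous W W'' → C W → C W'')
    (hPub : Literature.Uncategorized.OrdPublishedInputsAtTwo) (hCassels : bsdRHS_eq_of_isIsogenous)
    (hAU : abbesUllmo_not_dvd_maninConstant_of_not_dvd_level) (hex : exists_optimal_gamma1ParametrizationData)
    (hΛC : ∀ (W : WeierstrassCurve ℚ) [W.IsElliptic] [W.IsGloballyMinimal], ¬ W.HasCM → GoodOrd W 2 → C W →
      LambdaHalfAtTwo W)
    (W : WeierstrassCurve ℚ) [W.IsElliptic] [W.IsGloballyMinimal] (hcm : ¬ W.HasCM) (hr : W.analyticRank = 0)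
    (hgo : GoodOrd W 2) (hCW : C W) : MissingLowerBoundAt W 2 := by
  have hPub' := hPub
  obtain ⟨hmod, hGZK, h17, hGr⟩ := hPub'
  have hnf : exists_isNewformOf := exists_isNewformOf_of_nonempty_modularParametrizationData hPub.1
  -- the `μ_an ≤ 0` witness of the line, isogenous to `W`
  have hμ : ∃ (W'' : WeierstrassCurve ℚ) (_ : W''.IsElliptic) (_ : W''.IsGloballyMinimal),
      IsIsogenous W W'' ∧ AnalyticMuLE W'' 2 0 := by
    by_cases h2 : ∃ x : ℚ, HasRationalTwoTorsionX W x
    · obtain ⟨W'', hE, hM, hiso, hP⟩ := stub_maxPeriodWitness W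
      exact ⟨W'', hE, hM, hiso,
        stubAtMaxPeriod_of_periodDescentOfMeasureDepth hnf hAU
          (Summit.BirchSwinnertonDyer.BirchSwinnertonDyer.Theorems.AnalyticMuTwo.periodDescentOfMeasureDepth_of_flatWitness_of_eisensteinDescent
            Summit.BirchSwinnertonDyer.BirchSwinnertonDyer.Theorems.FlatWitnessTwo.flatWitnessAtTwo
            (Summit.BirchSwinnertonDyer.BirchSwinnertonDyer.Theorems.AnalyticMuTwo.periodDescentOfEisenstein_of_gamma1Optimal
              hex hPub hAU)) W W'' hcm hr hgo hiso h2 hP⟩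
    · push Not at h2
      exact ⟨W, ‹_›, ‹_›, isIsogenous_self W,
        analyticMuLE_two_zero_of_noRationalTwoTorsion_of_abbesUllmo W hAU hgo h2⟩
  obtain ⟨W'', _, _, hiso'', hμ''⟩ := hμ
  have hcm'' : ¬ W''.HasCM := fun h => hcm ((X12.hasCM_iff_of_isIsogenous hiso'').mpr h)
  have hr'' : W''.analyticRank = 0 := by rw [← analyticRank_eq_of_isIsogenous' hiso'']; exact hr
  have hgo'' : GoodOrd W'' 2 := isOrdinaryAt_of_isIsogenous hiso'' hgo
  exact missingLowerBoundAt_two_of_isIsogenous W hCassels hGZK hmod hr hiso''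
    (missingLowerBoundAt_two_of_lambdaHalf_of_analyticMuLE W'' hmod hGZK (h17 W'')
      (twoAdicEulerCharRankZero_zero_of_greenberg W'' hGr) hgo'' hr'' (hΛC W'' hcm'' hgo'' (hC W W'' hiso'' hCW)) hμ'')

/-! ## §2 The `E[2]`-irreducible branch: per curve, λ-half AT `W` only, no isogeny input -/

/-- **Item 19577 AT an `E[2]`-IRREDUCIBLE non-CM rank-`0` good-ordinary `W` from PUB, Abbes–Ullmo and the λ-half AT `W`
ITSELF** (`LambdaHalfAtTwo W`, the per-curve body of crux 19556): the `μ`-witness is `W`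
(`AnalyticMuTwo.analyticMuLE_two_zero_of_goodOrd_of_irr_of_abbesUllmo`), so no selector, no Cassels, no T2.  Conditional;
closes nothing. [cite: Kato2004Asterisque, Thm. 17.4] [cite: AbbesUllmo1996, Thm. A] -/
theorem missingLowerBoundAt_two_of_irr_of_lambdaHalfAt
    (hPub : Literature.Uncategorized.OrdPublishedInputsAtTwo) (hAU : abbesUllmo_not_dvd_maninConstant_of_not_dvd_level)
    (W : WeierstrassCurve ℚ) [W.IsElliptic] [W.IsGloballyMinimal] (hr : W.analyticRank = 0) (hgo : GoodOrd W 2)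
    (hirr : W.HasIrreducibleModPGaloisRep 2) (hL : LambdaHalfAtTwo W) : MissingLowerBoundAt W 2 := by
  have hPub' := hPub
  obtain ⟨hmod, hGZK, h17, hGr⟩ := hPub'
  exact missingLowerBoundAt_two_of_lambdaHalf_of_analyticMuLE W hmod hGZK (h17 W)
    (twoAdicEulerCharRankZero_zero_of_greenberg W hGr) hgo hr hL
    (Summit.BirchSwinnertonDyer.BirchSwinnertonDyer.Theorems.AnalyticMuTwo.analyticMuLE_two_zero_of_goodOrd_of_irr_of_abbesUllmo
      W hAU hgo hirr)

/-- **Item 19577 on the `E[2]`-IRREDUCIBLE locus from PUB, Abbes–Ullmo and crux 19556's registered stub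
`stub_irreducibleResidual` VERBATIM** (`∀ W, ¬CM → GoodOrd W 2 → E[2] irreducible → LambdaHalfAtTwo W`).  Conditional;
closes nothing. [cite: Kato2004Asterisque, Thm. 17.4] [cite: AbbesUllmo1996, Thm. A] -/
theorem missingLowerBoundAt_two_of_irr_of_lambdaHalfIrr
    (hPub : Literature.Uncategorized.OrdPublishedInputsAtTwo) (hAU : abbesUllmo_not_dvd_maninConstant_of_not_dvd_level)
    (hΛirr : ∀ (W : WeierstrassCurve ℚ) [W.IsElliptic] [W.IsGloballyMinimal], ¬ W.HasCM → GoodOrd W 2 →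
      W.HasIrreducibleModPGaloisRep 2 → LambdaHalfAtTwo W)
    (W : WeierstrassCurve ℚ) [W.IsElliptic] [W.IsGloballyMinimal] (hcm : ¬ W.HasCM) (hr : W.analyticRank = 0)
    (hgo : GoodOrd W 2) (hirr : W.HasIrreducibleModPGaloisRep 2) : MissingLowerBoundAt W 2 :=
  missingLowerBoundAt_two_of_irr_of_lambdaHalfAt hPub hAU W hr hgo hirr (hΛirr W hcm hgo hirr)

/-! ## §3 The `E[2]`-reducible branch -/

/-- **Item 19577 on the `E[2]`-REDUCIBLE locus from PUB, Cassels, Abbes–Ullmo, T2 and the λ-half on the non-CM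
good-ordinary `E[2]`-reducible curves** (the Kato–Greenberg / `W̄`-step / GL₁ branch of crux 19556's skeleton): §1 with
`C W := ¬ E[2] irreducible`, an isogeny-class property (`Rank1Residual.not_hasIrreducibleModPGaloisRep_of_isIsogenous`: a
rational line goes to a rational line).  Conditional; closes nothing.
[cite: Kato2004Asterisque, Thm. 17.4] [cite: Stevens1989, §2] [cite: AbbesUllmo1996, Thm. A] -/
theorem missingLowerBoundAt_two_of_red_of_lambdaHalfRed
    (hPub : Literature.Uncategorized.OrdPublishedInputsAtTwo) (hCassels : bsdRHS_eq_of_isIsogenous)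
    (hAU : abbesUllmo_not_dvd_maninConstant_of_not_dvd_level) (hex : exists_optimal_gamma1ParametrizationData)
    (hΛred : ∀ (W : WeierstrassCurve ℚ) [W.IsElliptic] [W.IsGloballyMinimal], ¬ W.HasCM → GoodOrd W 2 →
      ¬ W.HasIrreducibleModPGaloisRep 2 → LambdaHalfAtTwo W)
    (W : WeierstrassCurve ℚ) [W.IsElliptic] [W.IsGloballyMinimal] (hcm : ¬ W.HasCM) (hr : W.analyticRank = 0)
    (hgo : GoodOrd W 2) (hred : ¬ W.HasIrreducibleModPGaloisRep 2) : MissingLowerBoundAt W 2 :=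
  missingLowerBoundAt_two_on_of_lambdaHalf_on (fun V => ¬ V.HasIrreducibleModPGaloisRep 2)
    (fun _ _ _ _ hiso hV => Rank1Residual.not_hasIrreducibleModPGaloisRep_of_isIsogenous hiso hV)
    hPub hCassels hAU hex hΛred W hcm hr hgo hred

/-! ## §4 The leaf from the two branch hypotheses -/

/-- **K4's descent crux (leaf `Theorems.OrdHalvesAtTwo.OrdMissingLowerBoundAtTwo`) from the λ-half GIVEN BY IMAGE**:
PUB ∧ Cassels ∧ Abbes–Ullmo ∧ T2 ∧ (λ-half on the `E[2]`-irreducible non-CM good-ordinary curves = 19556's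
`stub_irreducibleResidual`) ∧ (λ-half on the `E[2]`-reducible ones) ⟹ the leaf — p668589 with its λ-input split along the
image of `ρ̄_{E,2}`.  Conditional; closes nothing. [cite: Kato2004Asterisque, Thm. 17.4] [cite: Stevens1989, §2] -/
theorem ordMissingLowerBoundAtTwo_of_lambdaHalfIrr_of_lambdaHalfRed
    (hPub : Literature.Uncategorized.OrdPublishedInputsAtTwo) (hCassels : bsdRHS_eq_of_isIsogenous)
    (hAU : abbesUllmo_not_dvd_maninConstant_of_not_dvd_level) (hex : exists_optimal_gamma1ParametrizationData)
    (hΛirr : ∀ (W : WeierstrassCurve ℚ) [W.IsElliptic] [W.IsGloballyMinimal], ¬ W.HasCM → GoodOrd W 2 →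
      W.HasIrreducibleModPGaloisRep 2 → LambdaHalfAtTwo W)
    (hΛred : ∀ (W : WeierstrassCurve ℚ) [W.IsElliptic] [W.IsGloballyMinimal], ¬ W.HasCM → GoodOrd W 2 →
      ¬ W.HasIrreducibleModPGaloisRep 2 → LambdaHalfAtTwo W) :
    Summit.BirchSwinnertonDyer.BirchSwinnertonDyer.Theorems.OrdHalvesAtTwo.OrdMissingLowerBoundAtTwo := by
  intro W _ _ hcm hr hgo
  by_cases hirr : W.HasIrreducibleModPGaloisRep 2
  · exact missingLowerBoundAt_two_of_irr_of_lambdaHalfIrr hPub hAU hΛirr W hcm hr hgo hirr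
  · exact missingLowerBoundAt_two_of_red_of_lambdaHalfRed hPub hCassels hAU hex hΛred W hcm hr hgo hirr

/-- **Sanity (the split loses nothing): the two branch hypotheses together ARE crux 19556** (`OrdLambdaHalfAtTwo`, by
excluded middle on the image), so §4 re-derives p668589. [cite: Kato2004Asterisque, Thm. 17.4] -/
theorem ordLambdaHalfAtTwo_iff_irr_and_red :
    TwoAdicTwistConverse.OrdLambdaHalfAtTwo ↔
      ((∀ (W : WeierstrassCurve ℚ) [W.IsElliptic] [W.IsGloballyMinimal], ¬ W.HasCM → GoodOrd W 2 →
          W.HasIrreducibleModPGaloisRep 2 → LambdaHalfAtTwo W) ∧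
        (∀ (W : WeierstrassCurve ℚ) [W.IsElliptic] [W.IsGloballyMinimal], ¬ W.HasCM → GoodOrd W 2 →
          ¬ W.HasIrreducibleModPGaloisRep 2 → LambdaHalfAtTwo W)) := by
  constructor
  · intro h
    exact ⟨fun W _ _ hcm hgo _ => h W hcm hgo, fun W _ _ hcm hgo _ => h W hcm hgo⟩
  · rintro ⟨hI, hR⟩ W _ _ hcm hgo
    by_cases hirr : W.HasIrreducibleModPGaloisRep 2
    · exact hI W hcm hgo hirr
    · exact hR W hcm hgo hirr

/-- **p668589 re-derived through the split** (same five hypotheses; the image split loses nothing).  Conditional; closes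
nothing. [cite: Kato2004Asterisque, Thm. 17.4] [cite: Stevens1989, §2] -/
theorem ordMissingLowerBoundAtTwo_of_published_of_lambdaHalf_byImage
    (hPub : Literature.Uncategorized.OrdPublishedInputsAtTwo) (hCassels : bsdRHS_eq_of_isIsogenous)
    (hAU : abbesUllmo_not_dvd_maninConstant_of_not_dvd_level) (hex : exists_optimal_gamma1ParametrizationData)
    (hΛ : TwoAdicTwistConverse.OrdLambdaHalfAtTwo) :
    Summit.BirchSwinnertonDyer.BirchSwinnertonDyer.Theorems.OrdHalvesAtTwo.OrdMissingLowerBoundAtTwo :=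
  ordMissingLowerBoundAtTwo_of_lambdaHalfIrr_of_lambdaHalfRed hPub hCassels hAU hex
    (ordLambdaHalfAtTwo_iff_irr_and_red.mp hΛ).1 (ordLambdaHalfAtTwo_iff_irr_and_red.mp hΛ).2

end Summit.BirchSwinnertonDyer.BirchSwinnertonDyer.Theorems.KatoFreeSandwich

end
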